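import Literature.AlgebraicTopology.Homotopy.CollaredDeformationRetract
import Mathlib.Topology.Homotopy.Equiv
import Mathlib.Analysis.InnerProductSpace.PiL2
import Mathlib.Analysis.SpecialFunctions.Trigonometric.Inverse
import Mathlib.Topology.MetricSpace.ProperSpace
import HarnessLib

/-!
# A space made of two contractible closed pieces joined by a cylinder `X × [0, 1]` is homotopy equivalent to the suspension of `X`

Topic `Literature/AlgebraicTopology/Homotopy`. Elementary homotopy theory (explicit homotopies, no
homology), absent from Mathlib, written for the decomposition of the named fact
`Literature.Topology.FourManifolds.HomotopySphere.nonempty_homotopyEquiv_sphere_of_isConnectedSum`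
(`Literature/Topology/FourManifolds/HomotopySpheresGroup.lean`; Kervaire–Milnor, *Groups of
homotopy spheres I*, Ann. of Math. 77 (1963), §2, p. 505: "It is clear that the sum of two
homotopy `n`-spheres is a homotopy `n`-sphere"): a connected sum `Σ₁ # Σ₂` is the union of the two
punctured-disc complements `Σᵢ ∖ disc` (contractible when `Σᵢ` is a homotopy sphere — Kosinski,
*Differential Manifolds* (1993), VI §1, remark before Cor. 1.4) joined by the tube
`Sⁿ⁻¹ × [0, 1]`, and such a space is homotopy equivalent to the suspension `Σ Sⁿ⁻¹ = Sⁿ`. This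
file proves the abstract statement behind the last step.

**Theorem** (`Literature.AlgebraicTopology.Homotopy.SuspensionLikeCover.nonempty_homotopyEquiv`). Let `X` be compact and `P`, `Q`
Hausdorff. Suppose

* (`Literature.SuspensionLikeCover X P`) `P = B₀ ∪ B₁ ∪ e (X × [0, 1])` with `B₀`, `B₁` closed and
  disjoint, `e : X × [0, 1] → P` continuous and injective, `e (X × {0}) ⊆ B₀`,
  `e (X × {1}) ⊆ B₁`, and `e (x, s) ∈ B₀ ⇒ s = 0`, `e (x, s) ∈ B₁ ⇒ s = 1` (so the open tube
  `e (X × (0, 1))` misses both pieces);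
* (`Literature.SuspensionModel X Q`) `Q = {N, S} ∪ σ (X × [0, 1])` for a continuous
  `σ : X × [0, 1] → Q` with `σ (X × {0}) = N ≠ S = σ (X × {1})` which is injective except for
  these two collapses (a concrete model of the unreduced suspension of `X`; for `X = ∅` the
  two-point space).

If `B₀` and `B₁` are contractible, then `P ≃ₕ Q` (a homotopy equivalence).

This is the classical fact that collapsing a contractible closed subspace along which the pair
has the homotopy extension property (here: a collared one) is a homotopy equivalence (Hatcher,
*Algebraic Topology* (2002), Prop. 0.17 with Example 0.15), applied twice, `P → P/B₀ → P/(B₀ ⊔ B₁)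
≅ Σ X`; as Mathlib has neither quotient-space homotopy theory nor the homotopy extension
property, the homotopy equivalence and both homotopies are written down directly.

**Proof.** Fix contractions `C⁰ : [0,1] × B₀ → B₀`, `C¹ : [0,1] × B₁ → B₁` to points `p₀`, `p₁`.
* `f : P → Q` (`toModel`): `f = N` on `B₀`, `f = S` on `B₁`, `f (e (x, s)) = σ (x, s)`;
  continuous by pasting on the closed cover `{e (X × [0,1]), B₀, B₁}` (`e` is a closed embedding).
* The deformation `K : [0,1] × P → P` (`deform`): `K_τ = C⁰_τ` on `B₀`, `K_τ = C¹_τ` on `B₁`, and on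
  the tube, with breakpoints moving with `τ`,
  `K_τ (e (x, s)) = C⁰_{τ-3s} (e (x, 0))` for `3s ≤ τ`, `= e (x, (3s-τ)/(3-2τ))` for
  `τ ≤ 3s ≤ 3 - τ`, `= C¹_{3s-3+τ} (e (x, 1))` for `3s ≥ 3 - τ`. Then `K₀ = id`.
* `g : Q → P` (`ofModel`): `g N = p₀`, `g S = p₁`, `g (σ (x, s)) = K₁ (e (x, s))`, i.e.
  `C⁰_{1-3s} (e (x,0))`, `e (x, 3s-1)`, `C¹_{3s-2} (e (x,1))` on the three thirds; well defined
  since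
  `K₁ (e (x, 0)) = p₀`, `K₁ (e (x, 1)) = p₁`; continuous because `σ` is a quotient map onto its
  (closed) range (compact to Hausdorff) and `Q` is covered by the closed sets `range σ`, `{N}`,
  `{S}`. By construction `K₁ = g ∘ f`, so `g ∘ f ≃ id_P`.
* `f ∘ g` fixes `N`, `S` and maps `σ (x, s) ↦ σ (x, λ s)` with `λ s = clamp (3s - 1)`; the linear
  interpolation `σ (x, (1-τ) λ s + τ s)` (`SuspensionModel.reparamHomotopyFun`) is a well defined
  homotopy `f ∘ g ≃ id_Q` because `λ 0 = 0`, `λ 1 = 1`.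

**The sphere** (§5, `Literature.sphereSuspensionModel n`). Polar coordinates
`σ : Sⁿ⁻¹ × [0, 1] → Sⁿ`, `σ (u, s) = (sin (π s) u, cos (π s))` (last coordinate `cos (π s)`),
exhibit the unit sphere `𝕊ⁿ ⊂ ℝⁿ⁺¹` as a suspension model of `Sⁿ⁻¹ = sphere (0 : ℝⁿ) 1` for every
`n : ℕ`, with poles `N = (0, …, 0, 1)`, `S = (0, …, 0, -1)`: `σ` is continuous, `σ (u, 0) = N`,
`σ (u, 1) = S`, its other fibres are points (`cos` is injective on `[0, π]`, `sin (π s) ≠ 0` for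
`0 < s < 1`), and every `y ∈ 𝕊ⁿ` with `y' = (y₀, …, y_{n-1}) ≠ 0` is `σ (y'/‖y'‖, arccos (yₙ)/π)`
— the homeomorphism `Σ Sⁿ⁻¹ ≅ Sⁿ` (Hatcher, *Algebraic Topology* (2002), p. 8, `S Sⁿ = Sⁿ⁺¹`);
for `n = 0`, `S⁻¹ = ∅` and `S⁰ = {N, S}`. Consequently (`nonempty_homotopyEquiv_sphere`) a
suspension-like space over `Sⁿ⁻¹` with contractible pieces is homotopy equivalent to `𝕊ⁿ`.

## References

* A. Hatcher, *Algebraic Topology*, CUP (2002), Ch. 0: Example 0.15, Prop. 0.17 (collapsing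
  contractible subcomplexes), p. 8 (suspension). [HatcherAT2002]
* A. Kosinski, *Differential Manifolds*, Academic Press (1993), Ch. VI §§1–2. [Kosinski1993]
* M. Kervaire, J. Milnor, *Groups of homotopy spheres I*, Ann. of Math. 77 (1963), §2.
  [KervaireMilnorAnnals1963]

## Design notes

* Pieces are `Set`s of `P`; contractibility enters through Mathlib's `ContractibleSpace` on the
  subtypes and the chosen contractions `Literature.AlgebraicTopology.Homotopy.ctrMap` of `CollaredDeformationRetract.lean`, whose
  clamp `Literature.clampI : ℝ → [0,1]` is used for all reparametrisations.
* All maps are first defined as plain functions by case distinction (`toModelFun`, `deformFun`,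
  `ofModelFun`, `reparamHomotopyFun`), their values on the pieces are computed, and continuity
  is proved by pasting along finite closed covers (`ContinuousOn.union_of_isClosed`) using the two
  lemmas `continuousOn_range_of_isEmbedding`, `continuousOn_range_of_compactSpace`.
* Appending/dropping the last Euclidean coordinate (`SphereSuspension.snoc`, `init`) is redone
  here (20 lines, own namespace) rather than imported from
  `Literature/AlgebraicTopology/SingularHomology/SphereComplement.lean`, to keep this file free
  of the singular-homology library.
* No named facts are introduced; nothing in this file uses `sorry`.
-/

open Set Function Topology
open scoped unitInterval Topology ContinuousMap

noncomputable section

namespace Literature.AlgebraicTopology.Homotopy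

universe u v w

attribute [local instance] Classical.propDecidable

/-! ### §0 Pasting lemmas -/

section Pasting

variable {A : Type*} {B : Type*} {Z : Type*} [TopologicalSpace A] [TopologicalSpace B]
  [TopologicalSpace Z]

/-- If `ψ : A → B` is an embedding, a function on `B` is continuous on `range ψ` as soon as its
composite with `ψ` is continuous. [folklore] -/
theorem continuousOn_range_of_isEmbedding {ψ : A → B} (hψ : IsEmbedding ψ) {F : B → Z}
    (hF : Continuous (F ∘ ψ)) : ContinuousOn F (range ψ) := by
  rw [continuousOn_iff_continuous_restrict]
  have h : (range ψ).restrict F = (F ∘ ψ) ∘ hψ.toHomeomorph.symm := by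
    funext ⟨b, hb⟩
    obtain ⟨a, rfl⟩ := hb
    simp only [restrict_apply, comp_apply]
    rw [hψ.toHomeomorph_symm_apply]
  rw [h]
  exact hF.comp (Homeomorph.continuous _)

/-- If `ψ : A → B` is continuous from a compact space to a Hausdorff space (hence a quotient map
onto its range), a function on `B` is continuous on `range ψ` as soon as its composite with `ψ`
is continuous. [folklore] -/
theorem continuousOn_range_of_compactSpace [CompactSpace A] [T2Space B] {ψ : A → B}
    (hψ : Continuous ψ) {F : B → Z} (hF : Continuous (F ∘ ψ)) : ContinuousOn F (range ψ) := by
  rw [continuousOn_iff_continuous_restrict]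
  have hq : IsQuotientMap (rangeFactorization ψ) :=
    hψ.rangeFactorization.isClosedMap.isQuotientMap hψ.rangeFactorization
      rangeFactorization_surjective
  rw [hq.continuous_iff]
  exact hF

end Pasting

/-! ### §1 Suspension models and suspension-like covers -/

/-- **A model of the (unreduced) suspension of `X` inside `Q`.** A continuous map
`σ : X × [0, 1] → Q` collapsing `X × {0}` to a point `north` and `X × {1}` to a different point
`south`, injective otherwise, such that `Q = {north, south} ∪ σ (X × [0, 1])`. When `X` is
compact and `Q` Hausdorff, `σ` is a quotient map onto its image, so `Q` is homeomorphic to the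
unreduced suspension `Σ X = X × [0,1] / (X × {0}, X × {1})` (for `X = ∅`: the two-point space)
(Hatcher, *Algebraic Topology* (2002), Ch. 0, p. 8). Example: polar coordinates
`(u, s) ↦ (sin (π s) u, cos (π s))` exhibit `Sⁿ` as a suspension model of `Sⁿ⁻¹`. [folklore] -/
structure SuspensionModel (X : Type u) (Q : Type v) [TopologicalSpace X] [TopologicalSpace Q] where
  /-- The suspension coordinates `σ : X × [0, 1] → Q`. -/
  map : X × I → Q
  /-- The image of `X × {0}`. -/
  north : Q
  /-- The image of `X × {1}`. -/
  south : Q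
  /-- `σ` is continuous. -/
  continuous_map : Continuous map
  /-- `σ (x, 0) = north`. -/
  map_zero : ∀ x, map (x, 0) = north
  /-- `σ (x, 1) = south`. -/
  map_one : ∀ x, map (x, 1) = south
  /-- The two poles are different. -/
  north_ne_south : north ≠ south
  /-- `Q = {north, south} ∪ range σ`. -/
  cover : ∀ q, q = north ∨ q = south ∨ q ∈ range map
  /-- `σ` only identifies points of `X × {0}` and points of `X × {1}`. -/
  eq_of_map_eq : ∀ ⦃x x' : X⦄ ⦃s s' : I⦄, map (x, s) = map (x', s') →
    s = s' ∧ (x = x' ∨ s = 0 ∨ s = 1)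

/-- **A suspension-like closed cover of `P` over `X`.** The space `P` is the union of two closed
disjoint pieces `body₀`, `body₁` and of an embedded cylinder `neck : X × [0, 1] → P` (continuous
and injective) attached to `body₀` along `X × {0}` and to `body₁` along `X × {1}`:
`neck (x, 0) ∈ body₀`, `neck (x, 1) ∈ body₁`, and conversely a point `neck (x, s)` of `body₀`
(resp. `body₁`) has `s = 0` (resp. `s = 1`). Example: a connected sum `M₀ # M₁` is covered by the
two disc complements `Mᵢ ∖ (open disc)` and the tube `Sⁿ⁻¹ × [0,1]` (Kervaire–Milnor 1963, §2;
Kosinski, *Differential Manifolds* (1993), VI §2). [folklore] -/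
structure SuspensionLikeCover (X : Type u) (P : Type w) [TopologicalSpace X]
    [TopologicalSpace P] where
  /-- The cylinder `X × [0, 1] → P`. -/
  neck : X × I → P
  /-- The closed piece attached along `X × {0}`. -/
  body₀ : Set P
  /-- The closed piece attached along `X × {1}`. -/
  body₁ : Set P
  /-- The cylinder is continuous. -/
  continuous_neck : Continuous neck
  /-- The cylinder is injective. -/
  neck_injective : Injective neck
  /-- `body₀` is closed. -/
  isClosed_body₀ : IsClosed body₀
  /-- `body₁` is closed. -/
  isClosed_body₁ : IsClosed body₁
  /-- `P = body₀ ∪ body₁ ∪ neck (X × [0, 1])`. -/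
  cover : ∀ p, p ∈ body₀ ∨ p ∈ body₁ ∨ p ∈ range neck
  /-- The bottom of the cylinder lies in `body₀`. -/
  neck_zero_mem : ∀ x, neck (x, 0) ∈ body₀
  /-- The top of the cylinder lies in `body₁`. -/
  neck_one_mem : ∀ x, neck (x, 1) ∈ body₁
  /-- Only the bottom of the cylinder meets `body₀`. -/
  eq_zero_of_neck_mem : ∀ ⦃x : X⦄ ⦃s : I⦄, neck (x, s) ∈ body₀ → s = 0
  /-- Only the top of the cylinder meets `body₁`. -/
  eq_one_of_neck_mem : ∀ ⦃x : X⦄ ⦃s : I⦄, neck (x, s) ∈ body₁ → s = 1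
  /-- The two pieces are disjoint. -/
  disjoint : Disjoint body₀ body₁

/-! ### §2 The reparametrisation homotopy of a suspension model -/

namespace SuspensionModel

variable {X : Type u} {Q : Type v} [TopologicalSpace X] [TopologicalSpace Q]
  (m : SuspensionModel X Q)

/-- A point `σ (x, s)` equal to the north pole has `s = 0`. [folklore] -/
theorem eq_zero_of_map_eq_north {x : X} {s : I} (h : m.map (x, s) = m.north) : s = 0 := by
  rw [← m.map_zero x] at h
  exact (m.eq_of_map_eq h).1

/-- A point `σ (x, s)` equal to the south pole has `s = 1`. [folklore] -/
theorem eq_one_of_map_eq_south {x : X} {s : I} (h : m.map (x, s) = m.south) : s = 1 := by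
  rw [← m.map_one x] at h
  exact (m.eq_of_map_eq h).1

/-- `{north} ∪ {south} ∪ range σ = Q`. [folklore] -/
theorem union_eq_univ : ({m.north} ∪ {m.south} ∪ range m.map : Set Q) = univ := by
  refine eq_univ_of_forall fun q => ?_
  rcases m.cover q with h | h | h
  · exact Or.inl (Or.inl h)
  · exact Or.inl (Or.inr h)
  · exact Or.inr h

/-- The reparametrisation `λ s = clamp (3s - 1)` of `[0, 1]`: `0` on `[0, 1/3]`, `3s - 1` on
`[1/3, 2/3]`, `1` on `[2/3, 1]`. [folklore] -/
def reparam (s : I) : I := clampI (3 * (s : ℝ) - 1)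

/-- `λ` is continuous. [folklore] -/
theorem continuous_reparam : Continuous (reparam) :=
  continuous_clampI.comp ((continuous_const.mul continuous_subtype_val).sub continuous_const)

/-- `λ 0 = 0`. [folklore] -/
@[simp] theorem reparam_zero : reparam 0 = 0 :=
  clampI_of_nonpos (by norm_num)

/-- `λ 1 = 1`. [folklore] -/
@[simp] theorem reparam_one : reparam 1 = 1 :=
  clampI_of_one_le (by norm_num)

/-- **The reparametrisation homotopy** `Φ_τ (σ (x, s)) = σ (x, (1 - τ) λ s + τ s)`, `Φ_τ = id` on
the poles (and off `range σ`). [folklore] -/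
def reparamHomotopyFun (τ : I) (q : Q) : Q :=
  if h : q ∈ range m.map then
    m.map (h.choose.1, clampI ((1 - (τ : ℝ)) * (reparam h.choose.2 : ℝ) + τ * h.choose.2))
  else q

/-- The interpolated suspension coordinate only depends on the point `σ q`. [folklore] -/
theorem map_reparam_eq (τ : I) {q : X × I} {x : X} {s : I} (h : m.map q = m.map (x, s)) :
    m.map (q.1, clampI ((1 - (τ : ℝ)) * (reparam q.2 : ℝ) + τ * q.2)) =
      m.map (x, clampI ((1 - (τ : ℝ)) * (reparam s : ℝ) + τ * s)) := by
  obtain ⟨x', s'⟩ := q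
  obtain ⟨hs, hx⟩ := m.eq_of_map_eq h
  subst hs
  rcases hx with hx | h0 | h1
  · rw [hx]
  · -- both points are the north pole
    subst h0
    simp [m.map_zero]
  · subst h1
    simp [m.map_one]

/-- The value of `Φ_τ` in suspension coordinates. [folklore] -/
theorem reparamHomotopyFun_map (τ : I) (x : X) (s : I) :
    m.reparamHomotopyFun τ (m.map (x, s)) =
      m.map (x, clampI ((1 - (τ : ℝ)) * (reparam s : ℝ) + τ * s)) := by
  have h : m.map (x, s) ∈ range m.map := mem_range_self _
  rw [reparamHomotopyFun, dif_pos h]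
  exact m.map_reparam_eq τ h.choose_spec

/-- `Φ_τ` fixes the north pole. [folklore] -/
theorem reparamHomotopyFun_north (τ : I) : m.reparamHomotopyFun τ m.north = m.north := by
  by_cases h : m.north ∈ range m.map
  · obtain ⟨⟨x, s⟩, hxs⟩ := h
    have hs : s = 0 := m.eq_zero_of_map_eq_north hxs
    subst hs
    rw [← hxs, reparamHomotopyFun_map]
    simp [m.map_zero]
  · rw [reparamHomotopyFun, dif_neg h]

/-- `Φ_τ` fixes the south pole. [folklore] -/
theorem reparamHomotopyFun_south (τ : I) : m.reparamHomotopyFun τ m.south = m.south := by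
  by_cases h : m.south ∈ range m.map
  · obtain ⟨⟨x, s⟩, hxs⟩ := h
    have hs : s = 1 := m.eq_one_of_map_eq_south hxs
    subst hs
    rw [← hxs, reparamHomotopyFun_map]
    simp [m.map_one]
  · rw [reparamHomotopyFun, dif_neg h]

/-- `Φ₀ (σ (x, s)) = σ (x, λ s)`. [folklore] -/
theorem reparamHomotopyFun_zero_map (x : X) (s : I) :
    m.reparamHomotopyFun 0 (m.map (x, s)) = m.map (x, reparam s) := by
  rw [reparamHomotopyFun_map]
  simp

/-- `Φ₁ = id`. [folklore] -/
theorem reparamHomotopyFun_one (q : Q) : m.reparamHomotopyFun 1 q = q := by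
  rcases m.cover q with rfl | rfl | ⟨⟨x, s⟩, rfl⟩
  · exact m.reparamHomotopyFun_north 1
  · exact m.reparamHomotopyFun_south 1
  · rw [reparamHomotopyFun_map]
    simp

variable [CompactSpace X] [T2Space Q]

/-- `range σ` is closed. [folklore] -/
theorem isClosed_range_map : IsClosed (range m.map) :=
  (isCompact_range m.continuous_map).isClosed

/-- **`Φ` is jointly continuous**: on `[0,1] × range σ` because `id × σ` is a quotient map onto it
(compact to Hausdorff), on `[0,1] × {N}` and `[0,1] × {S}` because it is the second projection
there; these three closed sets cover. [folklore] -/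
theorem continuous_reparamHomotopyFun :
    Continuous fun z : I × Q => m.reparamHomotopyFun z.1 z.2 := by
  rw [← continuousOn_univ]
  have hcov : (univ : Set (I × Q)) =
      (univ : Set I) ×ˢ ({m.north} : Set Q) ∪ (univ : Set I) ×ˢ ({m.south} : Set Q) ∪
        (univ : Set I) ×ˢ range m.map := by
    rw [← prod_union, ← prod_union, m.union_eq_univ, univ_prod_univ]
  rw [hcov]
  refine ContinuousOn.union_of_isClosed (ContinuousOn.union_of_isClosed ?_ ?_
    (isClosed_univ.prod isClosed_singleton) (isClosed_univ.prod isClosed_singleton)) ?_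
    ((isClosed_univ.prod isClosed_singleton).union (isClosed_univ.prod isClosed_singleton))
    (isClosed_univ.prod m.isClosed_range_map)
  · refine continuousOn_snd.congr fun z hz => ?_
    have hz2 : z.2 = m.north := hz.2
    simp only [hz2, reparamHomotopyFun_north]
  · refine continuousOn_snd.congr fun z hz => ?_
    have hz2 : z.2 = m.south := hz.2
    simp only [hz2, reparamHomotopyFun_south]
  · have hr : (univ : Set I) ×ˢ range m.map = range (Prod.map id m.map) := by
      rw [range_prodMap, range_id]
    rw [hr]
    refine continuousOn_range_of_compactSpace (continuous_id.prodMap m.continuous_map) ?_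
    have heq : (fun z : I × Q => m.reparamHomotopyFun z.1 z.2) ∘ Prod.map id m.map =
        fun z : I × (X × I) => m.map (z.2.1,
          clampI ((1 - (z.1 : ℝ)) * (reparam z.2.2 : ℝ) + z.1 * z.2.2)) := by
      funext ⟨τ, x, s⟩
      exact m.reparamHomotopyFun_map τ x s
    rw [heq]
    refine m.continuous_map.comp ((continuous_fst.comp continuous_snd).prodMk
      (continuous_clampI.comp ?_))
    exact ((continuous_const.sub (continuous_subtype_val.comp continuous_fst)).mul
      (continuous_subtype_val.comp (continuous_reparam.comp (continuous_snd.comp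
        continuous_snd)))).add
      ((continuous_subtype_val.comp continuous_fst).mul
        (continuous_subtype_val.comp (continuous_snd.comp continuous_snd)))

end SuspensionModel

/-! ### §3 The comparison map `f : P → Q` -/

namespace SuspensionLikeCover

variable {X : Type u} {P : Type w} {Q : Type v} [TopologicalSpace X] [TopologicalSpace P]
  [TopologicalSpace Q] (c : SuspensionLikeCover X P) (m : SuspensionModel X Q)

/-- `range neck ∪ body₀ ∪ body₁ = P`. [folklore] -/
theorem union_eq_univ : range c.neck ∪ c.body₀ ∪ c.body₁ = univ := by
  refine eq_univ_of_forall fun p => ?_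
  rcases c.cover p with h | h | h
  · exact Or.inl (Or.inr h)
  · exact Or.inr h
  · exact Or.inl (Or.inl h)

/-- A point of `body₀` is not in `body₁`. [folklore] -/
theorem not_mem_body₁ {p : P} (hp : p ∈ c.body₀) : p ∉ c.body₁ :=
  fun h => Set.disjoint_left.1 c.disjoint hp h

/-- A point of `body₁` is not in `body₀`. [folklore] -/
theorem not_mem_body₀ {p : P} (hp : p ∈ c.body₁) : p ∉ c.body₀ :=
  fun h => Set.disjoint_left.1 c.disjoint h hp

/-- **The comparison map `f : P → Q`**: the poles on the two pieces, suspension coordinates on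
the cylinder. [folklore] -/
def toModelFun (p : P) : Q :=
  if h : p ∈ range c.neck then m.map h.choose else if p ∈ c.body₀ then m.north else m.south

/-- `f (neck q) = σ q`. [folklore] -/
theorem toModelFun_neck (q : X × I) : c.toModelFun m (c.neck q) = m.map q := by
  have h : c.neck q ∈ range c.neck := mem_range_self q
  rw [toModelFun, dif_pos h, c.neck_injective h.choose_spec]

/-- `f = north` on `body₀`. [folklore] -/
theorem toModelFun_of_mem_body₀ {p : P} (hp : p ∈ c.body₀) : c.toModelFun m p = m.north := by
  by_cases h : p ∈ range c.neck
  · obtain ⟨⟨x, s⟩, rfl⟩ := h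
    have hs : s = 0 := c.eq_zero_of_neck_mem hp
    subst hs
    rw [toModelFun_neck, m.map_zero]
  · rw [toModelFun, dif_neg h, if_pos hp]

/-- `f = south` on `body₁`. [folklore] -/
theorem toModelFun_of_mem_body₁ {p : P} (hp : p ∈ c.body₁) : c.toModelFun m p = m.south := by
  by_cases h : p ∈ range c.neck
  · obtain ⟨⟨x, s⟩, rfl⟩ := h
    have hs : s = 1 := c.eq_one_of_neck_mem hp
    subst hs
    rw [toModelFun_neck, m.map_one]
  · rw [toModelFun, dif_neg h, if_neg (c.not_mem_body₀ hp)]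

section Compact

variable [CompactSpace X] [T2Space P]

/-- The cylinder is a closed embedding (compact to Hausdorff). [folklore] -/
theorem isClosedEmbedding_neck : IsClosedEmbedding c.neck :=
  c.continuous_neck.isClosedEmbedding c.neck_injective

/-- The range of the cylinder is closed. [folklore] -/
theorem isClosed_range_neck : IsClosed (range c.neck) :=
  c.isClosedEmbedding_neck.isClosed_range

/-- **`f` is continuous** (pasting on the closed cover `{range neck, body₀, body₁}`). [folklore] -/
theorem continuous_toModelFun : Continuous (c.toModelFun m) := by
  rw [← continuousOn_univ, ← c.union_eq_univ]
  refine ContinuousOn.union_of_isClosed (ContinuousOn.union_of_isClosed ?_ ?_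
    c.isClosed_range_neck c.isClosed_body₀) ?_ (c.isClosed_range_neck.union c.isClosed_body₀)
    c.isClosed_body₁
  · refine continuousOn_range_of_isEmbedding c.isClosedEmbedding_neck.isEmbedding ?_
    have : c.toModelFun m ∘ c.neck = m.map := funext fun q => c.toModelFun_neck m q
    rw [this]
    exact m.continuous_map
  · exact continuousOn_const.congr fun p hp => c.toModelFun_of_mem_body₀ m hp
  · exact continuousOn_const.congr fun p hp => c.toModelFun_of_mem_body₁ m hp

/-- **The comparison map `f : P → Q`** as a continuous map. [folklore] -/
def toModel : C(P, Q) := ⟨c.toModelFun m, c.continuous_toModelFun m⟩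

/-- Unfolding of `toModel`. [folklore] -/
@[simp] theorem toModel_apply (p : P) : c.toModel m p = c.toModelFun m p := rfl

end Compact

/-! ### §4 The deformation `K` of `P` and the map `g : Q → P` -/

section Deform

/-- The centre `p₀ ∈ body₀` of the chosen contraction of `body₀`. [folklore] -/
def center₀ [ContractibleSpace c.body₀] : P := (ctrCenter c.body₀ : P)

/-- The centre `p₁ ∈ body₁` of the chosen contraction of `body₁`. [folklore] -/
def center₁ [ContractibleSpace c.body₁] : P := (ctrCenter c.body₁ : P)

/-- `p₀ ∈ body₀`. [folklore] -/
theorem center₀_mem [ContractibleSpace c.body₀] : c.center₀ ∈ c.body₀ := (ctrCenter c.body₀).2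

/-- `p₁ ∈ body₁`. [folklore] -/
theorem center₁_mem [ContractibleSpace c.body₁] : c.center₁ ∈ c.body₁ := (ctrCenter c.body₁).2

variable [ContractibleSpace c.body₀] [ContractibleSpace c.body₁]

/-- **The deformation in cylinder coordinates** `K_τ (neck (x, s))`, with breakpoints moving
with `τ`: `C⁰_{τ-3s} (neck (x, 0))` for `3s ≤ τ`, `neck (x, (3s-τ)/(3-2τ))` for
`τ ≤ 3s ≤ 3 - τ`, `C¹_{3s-3+τ} (neck (x, 1))` for `3 - τ ≤ 3s`. [folklore] -/
def deformNeck (τ : I) (q : X × I) : P :=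
  if 3 * (q.2 : ℝ) ≤ τ then
    (ctrMap c.body₀ (clampI ((τ : ℝ) - 3 * q.2), ⟨c.neck (q.1, 0), c.neck_zero_mem q.1⟩) : P)
  else if 3 * (q.2 : ℝ) ≤ 3 - τ then
    c.neck (q.1, clampI ((3 * (q.2 : ℝ) - τ) / (3 - 2 * τ)))
  else
    (ctrMap c.body₁ (clampI (3 * (q.2 : ℝ) - 3 + τ), ⟨c.neck (q.1, 1), c.neck_one_mem q.1⟩) : P)

/-- **`K` is jointly continuous in cylinder coordinates** (pasting along `3s = τ` and
`3s = 3 - τ`). [folklore] -/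
theorem continuous_deformNeck : Continuous fun z : I × (X × I) => c.deformNeck z.1 z.2 := by
  have h3s : Continuous fun z : I × (X × I) => 3 * ((z.2.2 : I) : ℝ) :=
    continuous_const.mul (continuous_subtype_val.comp (continuous_snd.comp continuous_snd))
  have hτ : Continuous fun z : I × (X × I) => ((z.1 : I) : ℝ) :=
    continuous_subtype_val.comp continuous_fst
  have hx : Continuous fun z : I × (X × I) => z.2.1 := continuous_fst.comp continuous_snd
  -- the three pieces
  have hA : Continuous fun z : I × (X × I) =>
      (ctrMap c.body₀ (clampI ((z.1 : ℝ) - 3 * z.2.2), ⟨c.neck (z.2.1, 0), c.neck_zero_mem z.2.1⟩)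
        : P) := by
    refine continuous_subtype_val.comp ((ctrMap c.body₀).continuous.comp
      ((continuous_clampI.comp (hτ.sub h3s)).prodMk ?_))
    exact (c.continuous_neck.comp (hx.prodMk continuous_const)).subtype_mk _
  have hB : Continuous fun z : I × (X × I) =>
      c.neck (z.2.1, clampI ((3 * (z.2.2 : ℝ) - z.1) / (3 - 2 * z.1))) := by
    refine c.continuous_neck.comp (hx.prodMk (continuous_clampI.comp ?_))
    refine (h3s.sub hτ).div (continuous_const.sub (continuous_const.mul hτ)) fun z => ?_
    have := unitInterval.le_one z.1
    intro h0
    linarith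
  have hD : Continuous fun z : I × (X × I) =>
      (ctrMap c.body₁ (clampI (3 * (z.2.2 : ℝ) - 3 + z.1),
        ⟨c.neck (z.2.1, 1), c.neck_one_mem z.2.1⟩)
        : P) := by
    refine continuous_subtype_val.comp ((ctrMap c.body₁).continuous.comp
      ((continuous_clampI.comp ((h3s.sub continuous_const).add hτ)).prodMk ?_))
    exact (c.continuous_neck.comp (hx.prodMk continuous_const)).subtype_mk _
  refine Continuous.if_le hA ?_ h3s hτ ?_
  · refine Continuous.if_le hB hD h3s (continuous_const.sub hτ) ?_
    rintro ⟨τ, x, s⟩ (h : 3 * (s : ℝ) = 3 - τ)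
    have hτ1 := unitInterval.le_one τ
    have h1 : (3 * (s : ℝ) - τ) / (3 - 2 * τ) = 1 := by
      rw [div_eq_one_iff_eq (by linarith)]
      linarith
    have h2 : 3 * (s : ℝ) - 3 + τ = 0 := by linarith
    simp only [h1, h2, clampI_one, clampI_zero, ctrMap_zero]
  · rintro ⟨τ, x, s⟩ (h : 3 * (s : ℝ) = τ)
    have hτ1 := unitInterval.le_one τ
    have h1 : (τ : ℝ) - 3 * s = 0 := by linarith
    have h2 : 3 * (s : ℝ) ≤ 3 - τ := by linarith
    have h3 : (3 * (s : ℝ) - τ) / (3 - 2 * τ) = 0 := by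
      rw [div_eq_zero_iff]
      exact Or.inl (by linarith)
    simp only [h1, clampI_zero, ctrMap_zero, if_pos h2, h3]

/-- `K₀ = id` on the cylinder. [folklore] -/
theorem deformNeck_zero (x : X) (s : I) : c.deformNeck 0 (x, s) = c.neck (x, s) := by
  unfold deformNeck
  have hs0 := unitInterval.nonneg s
  have hs1 := unitInterval.le_one s
  split_ifs with h h'
  · -- `3s ≤ 0`, so `s = 0`
    have hs : (s : ℝ) = 0 := by
      have : (3 : ℝ) * s ≤ 0 := by simpa using h
      linarith
    have hs' : s = 0 := Subtype.ext hs
    subst hs'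
    simp
  · simp only [Set.Icc.coe_zero, sub_zero, mul_zero]
    have : 3 * (s : ℝ) / 3 = s := by ring
    rw [this, clampI_coe]
  · exfalso
    apply h'
    simp only [Set.Icc.coe_zero, sub_zero]
    linarith

/-- `K_τ (neck (x, 0)) = C⁰_τ (neck (x, 0))`. [folklore] -/
theorem deformNeck_bot (τ : I) (x : X) :
    c.deformNeck τ (x, 0) = (ctrMap c.body₀ (τ, ⟨c.neck (x, 0), c.neck_zero_mem x⟩) : P) := by
  unfold deformNeck
  have h : 3 * ((0 : I) : ℝ) ≤ τ := by simpa using unitInterval.nonneg τ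
  rw [if_pos h]
  simp

/-- `K_τ (neck (x, 1)) = C¹_τ (neck (x, 1))`. [folklore] -/
theorem deformNeck_top (τ : I) (x : X) :
    c.deformNeck τ (x, 1) = (ctrMap c.body₁ (τ, ⟨c.neck (x, 1), c.neck_one_mem x⟩) : P) := by
  unfold deformNeck
  have hτ0 := unitInterval.nonneg τ
  have hτ1 := unitInterval.le_one τ
  have h : ¬ 3 * ((1 : I) : ℝ) ≤ τ := by
    simp only [Set.Icc.coe_one, mul_one, not_le]
    linarith
  rw [if_neg h]
  by_cases h' : 3 * ((1 : I) : ℝ) ≤ 3 - τ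
  · -- then `τ = 0`
    have hτ : (τ : ℝ) = 0 := by
      simp only [Set.Icc.coe_one, mul_one] at h'
      linarith
    have hτ' : τ = 0 := Subtype.ext hτ
    subst hτ'
    rw [if_pos h']
    simp
  · rw [if_neg h']
    simp

/-- `K₁ (neck (x, 0)) = p₀`. [folklore] -/
theorem deformNeck_one_bot (x : X) : c.deformNeck 1 (x, 0) = c.center₀ := by
  rw [deformNeck_bot, ctrMap_one]
  rfl

/-- `K₁ (neck (x, 1)) = p₁`. [folklore] -/
theorem deformNeck_one_top (x : X) : c.deformNeck 1 (x, 1) = c.center₁ := by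
  rw [deformNeck_top, ctrMap_one]
  rfl

/-- **`f ∘ K₁ = σ ∘ (id × λ)` on the cylinder**: `f (K₁ (neck (x, s))) = σ (x, λ s)`, the three
thirds of the cylinder going to `north`, `σ (x, 3s - 1)`, `south`. [folklore] -/
theorem toModelFun_deformNeck_one (x : X) (s : I) :
    c.toModelFun m (c.deformNeck 1 (x, s)) = m.map (x, SuspensionModel.reparam s) := by
  unfold deformNeck
  split_ifs with h h'
  · -- first third: lands in `body₀`
    rw [c.toModelFun_of_mem_body₀ m (Subtype.coe_prop _)]
    have hs : 3 * (s : ℝ) - 1 ≤ 0 := by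
      simp only [Set.Icc.coe_one] at h
      linarith
    rw [SuspensionModel.reparam, clampI_of_nonpos hs, m.map_zero]
  · -- middle third
    rw [toModelFun_neck]
    simp only [Set.Icc.coe_one]
    norm_num
    rfl
  · -- last third: lands in `body₁`
    rw [c.toModelFun_of_mem_body₁ m (Subtype.coe_prop _)]
    have hs : 1 ≤ 3 * (s : ℝ) - 1 := by
      simp only [Set.Icc.coe_one, not_le] at h'
      linarith
    rw [SuspensionModel.reparam, clampI_of_one_le hs, m.map_one]

/-- **The deformation `K : [0,1] × P → P`**: `K_τ = C⁰_τ` on `body₀`, `C¹_τ` on `body₁`,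
`deformNeck` on the cylinder (identity off the cover, which is empty). [folklore] -/
def deformFun (τ : I) (p : P) : P :=
  if h : p ∈ range c.neck then c.deformNeck τ h.choose
  else if h₀ : p ∈ c.body₀ then (ctrMap c.body₀ (τ, ⟨p, h₀⟩) : P)
  else if h₁ : p ∈ c.body₁ then (ctrMap c.body₁ (τ, ⟨p, h₁⟩) : P)
  else p

/-- `K` in cylinder coordinates. [folklore] -/
theorem deformFun_neck (τ : I) (q : X × I) : c.deformFun τ (c.neck q) = c.deformNeck τ q := by
  have h : c.neck q ∈ range c.neck := mem_range_self q
  rw [deformFun, dif_pos h, c.neck_injective h.choose_spec]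

/-- `K = C⁰` on `body₀`. [folklore] -/
theorem deformFun_of_mem_body₀ (τ : I) {p : P} (hp : p ∈ c.body₀) :
    c.deformFun τ p = (ctrMap c.body₀ (τ, ⟨p, hp⟩) : P) := by
  by_cases h : p ∈ range c.neck
  · obtain ⟨⟨x, s⟩, rfl⟩ := h
    have hs : s = 0 := c.eq_zero_of_neck_mem hp
    subst hs
    rw [deformFun_neck, deformNeck_bot]
  · rw [deformFun, dif_neg h, dif_pos hp]

/-- `K = C¹` on `body₁`. [folklore] -/
theorem deformFun_of_mem_body₁ (τ : I) {p : P} (hp : p ∈ c.body₁) :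
    c.deformFun τ p = (ctrMap c.body₁ (τ, ⟨p, hp⟩) : P) := by
  by_cases h : p ∈ range c.neck
  · obtain ⟨⟨x, s⟩, rfl⟩ := h
    have hs : s = 1 := c.eq_one_of_neck_mem hp
    subst hs
    rw [deformFun_neck, deformNeck_top]
  · rw [deformFun, dif_neg h, dif_neg (c.not_mem_body₀ hp), dif_pos hp]

/-- `K₀ = id`. [folklore] -/
theorem deformFun_zero (p : P) : c.deformFun 0 p = p := by
  rcases c.cover p with hp | hp | ⟨⟨x, s⟩, rfl⟩
  · rw [c.deformFun_of_mem_body₀ 0 hp, ctrMap_zero]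
  · rw [c.deformFun_of_mem_body₁ 0 hp, ctrMap_zero]
  · rw [deformFun_neck, deformNeck_zero]

/-- **The map `g : Q → P`**: `g N = p₀`, `g S = p₁`, `g (σ q) = K₁ (neck q)`. [folklore] -/
def ofModelFun (q : Q) : P :=
  if q = m.north then c.center₀ else if q = m.south then c.center₁
  else if h : q ∈ range m.map then c.deformNeck 1 h.choose else c.center₀

/-- `g N = p₀`. [folklore] -/
@[simp] theorem ofModelFun_north : c.ofModelFun m m.north = c.center₀ := by
  simp [ofModelFun]

/-- `g S = p₁`. [folklore] -/
@[simp] theorem ofModelFun_south : c.ofModelFun m m.south = c.center₁ := by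
  simp [ofModelFun, m.north_ne_south.symm]

/-- `K₁ ∘ neck` only depends on the point `σ q`, away from the poles. [folklore] -/
theorem deformNeck_one_eq_of_map_eq {q : X × I} {x : X} {s : I} (h : m.map q = m.map (x, s))
    (hN : m.map (x, s) ≠ m.north) (hS : m.map (x, s) ≠ m.south) :
    c.deformNeck 1 q = c.deformNeck 1 (x, s) := by
  obtain ⟨x', s'⟩ := q
  obtain ⟨hs, hx⟩ := m.eq_of_map_eq h
  subst hs
  rcases hx with hx | h0 | h1
  · rw [hx]
  · subst h0
    exact absurd (m.map_zero x) hN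
  · subst h1
    exact absurd (m.map_one x) hS

/-- **`g` is well defined**: `g (σ q) = K₁ (neck q)`. [folklore] -/
theorem ofModelFun_map (q : X × I) : c.ofModelFun m (m.map q) = c.deformNeck 1 q := by
  obtain ⟨x, s⟩ := q
  unfold ofModelFun
  by_cases hN : m.map (x, s) = m.north
  · have hs : s = 0 := m.eq_zero_of_map_eq_north hN
    subst hs
    rw [if_pos hN, deformNeck_one_bot]
  rw [if_neg hN]
  by_cases hS : m.map (x, s) = m.south
  · have hs : s = 1 := m.eq_one_of_map_eq_south hS
    subst hs
    rw [if_pos hS, deformNeck_one_top]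
  rw [if_neg hS]
  have h : m.map (x, s) ∈ range m.map := mem_range_self _
  rw [dif_pos h]
  exact c.deformNeck_one_eq_of_map_eq m h.choose_spec hN hS

/-- `K₁ = g ∘ f`. [folklore] -/
theorem deformFun_one (p : P) : c.deformFun 1 p = c.ofModelFun m (c.toModelFun m p) := by
  rcases c.cover p with hp | hp | ⟨q, rfl⟩
  · rw [c.deformFun_of_mem_body₀ 1 hp, ctrMap_one, c.toModelFun_of_mem_body₀ m hp,
      ofModelFun_north]
    rfl
  · rw [c.deformFun_of_mem_body₁ 1 hp, ctrMap_one, c.toModelFun_of_mem_body₁ m hp,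
      ofModelFun_south]
    rfl
  · rw [deformFun_neck, toModelFun_neck, ofModelFun_map]

/-- `f ∘ g = Φ₀` (the reparametrisation `σ (x, s) ↦ σ (x, λ s)`, poles fixed). [folklore] -/
theorem toModelFun_ofModelFun (q : Q) :
    c.toModelFun m (c.ofModelFun m q) = m.reparamHomotopyFun 0 q := by
  rcases m.cover q with rfl | rfl | ⟨⟨x, s⟩, rfl⟩
  · rw [ofModelFun_north, m.reparamHomotopyFun_north, c.toModelFun_of_mem_body₀ m c.center₀_mem]
  · rw [ofModelFun_south, m.reparamHomotopyFun_south, c.toModelFun_of_mem_body₁ m c.center₁_mem]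
  · rw [ofModelFun_map, toModelFun_deformNeck_one, m.reparamHomotopyFun_zero_map]

variable [CompactSpace X]

section OfModel

variable [T2Space Q]

/-- **`g` is continuous**: on `range σ` because `σ` is a quotient map onto it and
`g ∘ σ = K₁ ∘ neck`; `{N}`, `{S}`, `range σ` form a closed cover of `Q`. [folklore] -/
theorem continuous_ofModelFun : Continuous (c.ofModelFun m) := by
  rw [← continuousOn_univ, ← m.union_eq_univ]
  refine ContinuousOn.union_of_isClosed (ContinuousOn.union_of_isClosed
    (continuousOn_singleton _ _) (continuousOn_singleton _ _) isClosed_singleton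
    isClosed_singleton) ?_ (isClosed_singleton.union isClosed_singleton) m.isClosed_range_map
  refine continuousOn_range_of_compactSpace m.continuous_map ?_
  have heq : c.ofModelFun m ∘ m.map = fun q => c.deformNeck 1 q :=
    funext fun q => c.ofModelFun_map m q
  rw [heq]
  exact c.continuous_deformNeck.comp (continuous_const.prodMk continuous_id)

/-- **The map `g : Q → P`** as a continuous map. [folklore] -/
def ofModel : C(Q, P) := ⟨c.ofModelFun m, c.continuous_ofModelFun m⟩

/-- Unfolding of `ofModel`. [folklore] -/
@[simp] theorem ofModel_apply (q : Q) : c.ofModel m q = c.ofModelFun m q := rfl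

end OfModel

variable [T2Space P]

/-- **`K` is jointly continuous** (pasting on the closed cover
`[0,1] × {range neck, body₀, body₁}`). [folklore] -/
theorem continuous_deformFun : Continuous fun z : I × P => c.deformFun z.1 z.2 := by
  rw [← continuousOn_univ]
  have hcov : (univ : Set (I × P)) = (univ : Set I) ×ˢ range c.neck ∪ (univ : Set I) ×ˢ c.body₀ ∪
      (univ : Set I) ×ˢ c.body₁ := by
    rw [← prod_union, ← prod_union, c.union_eq_univ, univ_prod_univ]
  rw [hcov]
  refine ContinuousOn.union_of_isClosed (ContinuousOn.union_of_isClosed ?_ ?_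
    (isClosed_univ.prod c.isClosed_range_neck) (isClosed_univ.prod c.isClosed_body₀)) ?_
    ((isClosed_univ.prod c.isClosed_range_neck).union (isClosed_univ.prod c.isClosed_body₀))
    (isClosed_univ.prod c.isClosed_body₁)
  · have hr : (univ : Set I) ×ˢ range c.neck = range (Prod.map id c.neck) := by
      rw [range_prodMap, range_id]
    rw [hr]
    refine continuousOn_range_of_isEmbedding
      (IsEmbedding.id.prodMap c.isClosedEmbedding_neck.isEmbedding) ?_
    have heq : (fun z : I × P => c.deformFun z.1 z.2) ∘ Prod.map id c.neck =
        fun z : I × (X × I) => c.deformNeck z.1 z.2 := by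
      funext ⟨τ, q⟩
      exact c.deformFun_neck τ q
    rw [heq]
    exact c.continuous_deformNeck
  · have hr : (univ : Set I) ×ˢ c.body₀ = range (Prod.map id ((↑) : c.body₀ → P)) := by
      rw [range_prodMap, range_id, Subtype.range_coe]
    rw [hr]
    refine continuousOn_range_of_isEmbedding (IsEmbedding.id.prodMap IsEmbedding.subtypeVal) ?_
    have heq : (fun z : I × P => c.deformFun z.1 z.2) ∘ Prod.map id ((↑) : c.body₀ → P) =
        fun z : I × c.body₀ => (ctrMap c.body₀ (z.1, z.2) : P) := by
      funext ⟨τ, p⟩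
      exact c.deformFun_of_mem_body₀ τ p.2
    rw [heq]
    exact continuous_subtype_val.comp (ctrMap c.body₀).continuous
  · have hr : (univ : Set I) ×ˢ c.body₁ = range (Prod.map id ((↑) : c.body₁ → P)) := by
      rw [range_prodMap, range_id, Subtype.range_coe]
    rw [hr]
    refine continuousOn_range_of_isEmbedding (IsEmbedding.id.prodMap IsEmbedding.subtypeVal) ?_
    have heq : (fun z : I × P => c.deformFun z.1 z.2) ∘ Prod.map id ((↑) : c.body₁ → P) =
        fun z : I × c.body₁ => (ctrMap c.body₁ (z.1, z.2) : P) := by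
      funext ⟨τ, p⟩
      exact c.deformFun_of_mem_body₁ τ p.2
    rw [heq]
    exact continuous_subtype_val.comp (ctrMap c.body₁).continuous

variable [T2Space Q]

/-- **The homotopy `id_P ≃ g ∘ f`** given by `K`. [folklore] -/
def deform : ContinuousMap.Homotopy (ContinuousMap.id P) ((c.ofModel m).comp (c.toModel m)) where
  toFun z := c.deformFun z.1 z.2
  continuous_toFun := c.continuous_deformFun
  map_zero_left p := c.deformFun_zero p
  map_one_left p := c.deformFun_one m p

/-- **The homotopy `f ∘ g ≃ id_Q`** given by `Φ`. [folklore] -/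
def reparamHomotopy :
    ContinuousMap.Homotopy ((c.toModel m).comp (c.ofModel m)) (ContinuousMap.id Q) where
  toFun z := m.reparamHomotopyFun z.1 z.2
  continuous_toFun := m.continuous_reparamHomotopyFun
  map_zero_left q := (c.toModelFun_ofModelFun m q).symm
  map_one_left q := m.reparamHomotopyFun_one q

/-- **The homotopy equivalence `P ≃ₕ Q`.** [folklore] -/
def homotopyEquiv : P ≃ₕ Q where
  toFun := c.toModel m
  invFun := c.ofModel m
  left_inv := ⟨(c.deform m).symm⟩
  right_inv := ⟨c.reparamHomotopy m⟩

end Deform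

/-- **Theorem (suspension-like spaces).** Let `X` be compact, `P` and `Q` Hausdorff, `P` covered
by two disjoint closed contractible pieces and an embedded cylinder `X × [0,1]` joining them
(`SuspensionLikeCover`), and `Q` a model of the suspension of `X` (`SuspensionModel`). Then `P`
is homotopy equivalent to `Q`. (Hatcher, *Algebraic Topology* (2002), Prop. 0.17 and Example
0.15: collapsing the two contractible collared pieces, `P ≃ P/(B₀ ⊔ B₁) ≅ Σ X`.) [cite: HatcherAT2002, Ch. 0, Prop. 0.17 and Example 0.15] -/
theorem nonempty_homotopyEquiv [CompactSpace X] [T2Space P] [T2Space Q]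
    (c : SuspensionLikeCover X P) (m : SuspensionModel X Q)
    (h₀ : ContractibleSpace c.body₀) (h₁ : ContractibleSpace c.body₁) : Nonempty (P ≃ₕ Q) :=
  ⟨c.homotopyEquiv m⟩

end SuspensionLikeCover

/-! ### §5 The sphere `𝕊ⁿ` as a suspension model of `Sⁿ⁻¹` (polar coordinates) -/

section Sphere

open Metric Real

/-- Local notation: `𝔼 n` is the model Euclidean space `EuclideanSpace ℝ (Fin n)`. -/
local notation "𝔼 " n:arg => EuclideanSpace ℝ (Fin n)

/-- Local notation: `𝕊 n` is the unit sphere in `EuclideanSpace ℝ (Fin (n + 1))`. -/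
local notation "𝕊 " n:arg => (Metric.sphere (0 : EuclideanSpace ℝ (Fin (n + 1))) 1)

namespace SphereSuspension

variable {n : ℕ}

/-! ### Appending and dropping the last Euclidean coordinate -/

/-- Append a last coordinate: `(y, t) ↦ (y₀, …, y_{n-1}, t)`. [folklore] -/
def snoc (y : 𝔼 n) (t : ℝ) : 𝔼 (n + 1) := WithLp.toLp 2 (Fin.snoc (fun i => y i) t)

/-- Drop the last coordinate. [folklore] -/
def init (z : 𝔼 (n + 1)) : 𝔼 n := WithLp.toLp 2 (fun i => z i.castSucc)

/-- The first `n` coordinates of `snoc y t` are those of `y`. [folklore] -/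
@[simp] theorem snoc_apply_castSucc (y : 𝔼 n) (t : ℝ) (i : Fin n) :
    snoc y t i.castSucc = y i := by
  simp [snoc]

/-- The last coordinate of `snoc y t` is `t`. [folklore] -/
@[simp] theorem snoc_apply_last (y : 𝔼 n) (t : ℝ) : snoc y t (Fin.last n) = t := by
  simp [snoc]

/-- Coordinates of `init z`. [folklore] -/
@[simp] theorem init_apply (z : 𝔼 (n + 1)) (i : Fin n) : init z i = z i.castSucc := rfl

/-- Dropping the appended coordinate recovers `y`. [folklore] -/
@[simp] theorem init_snoc (y : 𝔼 n) (t : ℝ) : init (snoc y t) = y := by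
  ext i
  simp

/-- A vector is its initial part with its last coordinate appended. [folklore] -/
theorem snoc_init (z : 𝔼 (n + 1)) : snoc (init z) (z (Fin.last n)) = z := by
  ext i
  induction i using Fin.lastCases with
  | last => simp
  | cast i => simp

/-- `snoc` is injective in both arguments. [folklore] -/
theorem snoc_eq_snoc_iff {y y' : 𝔼 n} {t t' : ℝ} : snoc y t = snoc y' t' ↔ y = y' ∧ t = t' := by
  constructor
  · intro h
    refine ⟨by simpa using congrArg init h, ?_⟩
    simpa using congrArg (fun z : 𝔼 (n + 1) => z (Fin.last n)) h
  · rintro ⟨rfl, rfl⟩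
    rfl

/-- Pythagoras: `‖z‖² = ‖init z‖² + z_n²`. [folklore] -/
theorem norm_sq_eq_norm_init_sq_add (z : 𝔼 (n + 1)) :
    ‖z‖ ^ 2 = ‖init z‖ ^ 2 + z (Fin.last n) ^ 2 := by
  rw [EuclideanSpace.real_norm_sq_eq, EuclideanSpace.real_norm_sq_eq, Fin.sum_univ_castSucc]
  rfl

/-- Pythagoras: `‖(y, t)‖² = ‖y‖² + t²`. [folklore] -/
theorem norm_snoc_sq (y : 𝔼 n) (t : ℝ) : ‖snoc y t‖ ^ 2 = ‖y‖ ^ 2 + t ^ 2 := by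
  rw [norm_sq_eq_norm_init_sq_add, init_snoc, snoc_apply_last]

/-- Appending a coordinate is continuous. [folklore] -/
theorem continuous_snoc : Continuous (fun p : 𝔼 n × ℝ => snoc p.1 p.2) := by
  unfold snoc
  refine (PiLp.continuous_toLp 2 _).comp ?_
  refine Continuous.finSnoc ?_ continuous_snd
  exact continuous_pi fun i => (PiLp.continuous_apply 2 _ i).comp continuous_fst

/-- Dropping the last coordinate is continuous. [folklore] -/
theorem continuous_init : Continuous (init : 𝔼 (n + 1) → 𝔼 n) := by
  unfold init
  exact (PiLp.continuous_toLp 2 _).comp (continuous_pi fun i => PiLp.continuous_apply 2 _ _)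

/-! ### Polar coordinates on the sphere -/

/-- For a unit vector `u`, `‖(sin θ • u, cos θ)‖ = 1`. [folklore] -/
theorem norm_snoc_smul_cos (u : sphere (0 : 𝔼 n) 1) (θ : ℝ) :
    ‖snoc (Real.sin θ • (u : 𝔼 n)) (Real.cos θ)‖ = 1 := by
  have hu : ‖(u : 𝔼 n)‖ = 1 := norm_eq_of_mem_sphere u
  have h : ‖snoc (Real.sin θ • (u : 𝔼 n)) (Real.cos θ)‖ ^ 2 = 1 := by
    rw [norm_snoc_sq, norm_smul, hu, mul_one, Real.norm_eq_abs, sq_abs, Real.sin_sq_add_cos_sq]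
  nlinarith [norm_nonneg (snoc (Real.sin θ • (u : 𝔼 n)) (Real.cos θ))]

/-- **Polar coordinates** `σ (u, s) = (sin (π s) u, cos (π s)) ∈ Sⁿ` for `u ∈ Sⁿ⁻¹`,
`s ∈ [0, 1]` (Hatcher, *Algebraic Topology* (2002), p. 8: `S Sⁿ⁻¹ = Sⁿ`). [folklore] -/
def polar (n : ℕ) (q : sphere (0 : 𝔼 n) 1 × I) : 𝕊 n :=
  ⟨snoc (Real.sin (π * q.2) • (q.1 : 𝔼 n)) (Real.cos (π * q.2)),
    mem_sphere_zero_iff_norm.2 (norm_snoc_smul_cos q.1 _)⟩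

/-- Coordinates of `σ (u, s)`. [folklore] -/
@[simp] theorem coe_polar (q : sphere (0 : 𝔼 n) 1 × I) :
    (polar n q : 𝔼 (n + 1)) = snoc (Real.sin (π * q.2) • (q.1 : 𝔼 n)) (Real.cos (π * q.2)) :=
  rfl

/-- The north pole `N = (0, …, 0, 1)`. [folklore] -/
def north (n : ℕ) : 𝕊 n :=
  ⟨snoc 0 1, mem_sphere_zero_iff_norm.2 (by
    have h : ‖snoc (0 : 𝔼 n) 1‖ ^ 2 = 1 := by rw [norm_snoc_sq]; simp
    nlinarith [norm_nonneg (snoc (0 : 𝔼 n) 1)])⟩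

/-- The south pole `S = (0, …, 0, -1)`. [folklore] -/
def south (n : ℕ) : 𝕊 n :=
  ⟨snoc 0 (-1), mem_sphere_zero_iff_norm.2 (by
    have h : ‖snoc (0 : 𝔼 n) (-1)‖ ^ 2 = 1 := by rw [norm_snoc_sq]; simp
    nlinarith [norm_nonneg (snoc (0 : 𝔼 n) (-1))])⟩

/-- Coordinates of the north pole. [folklore] -/
@[simp] theorem coe_north : (north n : 𝔼 (n + 1)) = snoc 0 1 := rfl

/-- Coordinates of the south pole. [folklore] -/
@[simp] theorem coe_south : (south n : 𝔼 (n + 1)) = snoc 0 (-1) := rfl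

/-- The poles are different. [folklore] -/
theorem north_ne_south : north n ≠ south n := by
  intro h
  have h' := congrArg (fun y : 𝕊 n => (y : 𝔼 (n + 1)) (Fin.last n)) h
  simp only [coe_north, coe_south, snoc_apply_last] at h'
  norm_num at h'

/-- `σ` is continuous. [folklore] -/
theorem continuous_polar : Continuous (polar n) := by
  refine Continuous.subtype_mk (continuous_snoc.comp (Continuous.prodMk ?_ ?_)) _
  · exact ((Real.continuous_sin.comp (continuous_const.mul
      (continuous_subtype_val.comp continuous_snd))).smul
      (continuous_subtype_val.comp continuous_fst))
  · exact Real.continuous_cos.comp (continuous_const.mul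
      (continuous_subtype_val.comp continuous_snd))

/-- `σ (u, 0) = N`. [folklore] -/
@[simp] theorem polar_zero (u : sphere (0 : 𝔼 n) 1) : polar n (u, 0) = north n := by
  apply Subtype.ext
  simp

/-- `σ (u, 1) = S`. [folklore] -/
@[simp] theorem polar_one (u : sphere (0 : 𝔼 n) 1) : polar n (u, 1) = south n := by
  apply Subtype.ext
  simp

/-- For `s ∈ [0, 1]`, `sin (π s) = 0` forces `s = 0` or `s = 1`. [folklore] -/
theorem eq_zero_or_eq_one_of_sin_eq_zero {s : I} (h : Real.sin (π * s) = 0) : s = 0 ∨ s = 1 := by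
  rcases eq_or_ne s 0 with h0 | h0
  · exact Or.inl h0
  rcases eq_or_ne s 1 with h1 | h1
  · exact Or.inr h1
  exfalso
  have hs0 : (0 : ℝ) < s := lt_of_le_of_ne (unitInterval.nonneg s)
    (fun h0' => h0 (Subtype.ext h0'.symm))
  have hs1 : (s : ℝ) < 1 := lt_of_le_of_ne (unitInterval.le_one s)
    (fun h1' => h1 (Subtype.ext h1'))
  have hpos : 0 < Real.sin (π * s) :=
    Real.sin_pos_of_pos_of_lt_pi (mul_pos Real.pi_pos hs0)
      (by nlinarith [Real.pi_pos])
  exact hpos.ne' h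

/-- **Fibres of `σ`**: `σ (u, s) = σ (u', s')` forces `s = s'`, and `u = u'` unless `s ∈ {0, 1}`.
[folklore] -/
theorem eq_of_polar_eq {u u' : sphere (0 : 𝔼 n) 1} {s s' : I}
    (h : polar n (u, s) = polar n (u', s')) :
    s = s' ∧ (u = u' ∨ s = 0 ∨ s = 1) := by
  have h' := congrArg (fun y : 𝕊 n => (y : 𝔼 (n + 1))) h
  simp only [coe_polar, snoc_eq_snoc_iff] at h'
  obtain ⟨h1, h2⟩ := h'
  -- `cos` is injective on `[0, π]`
  have hs : s = s' := by
    have hmem : ∀ t : I, π * (t : ℝ) ∈ Icc 0 π := fun t =>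
      ⟨mul_nonneg Real.pi_pos.le (unitInterval.nonneg t),
        by nlinarith [Real.pi_pos, unitInterval.le_one t]⟩
    have := Real.injOn_cos (hmem s) (hmem s') h2
    exact Subtype.ext (mul_left_cancel₀ Real.pi_pos.ne' this)
  subst hs
  refine ⟨rfl, ?_⟩
  by_cases hsin : Real.sin (π * s) = 0
  · exact Or.inr (eq_zero_or_eq_one_of_sin_eq_zero hsin)
  · exact Or.inl (Subtype.ext (smul_right_injective _ hsin h1))

/-- The last coordinate of a point of `𝕊ⁿ` lies in `[-1, 1]`, with `‖init y‖² = 1 - y_n²`.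
[folklore] -/
theorem norm_init_sq (y : 𝕊 n) :
    ‖init (y : 𝔼 (n + 1))‖ ^ 2 = 1 - ((y : 𝔼 (n + 1)) (Fin.last n)) ^ 2 := by
  have hy : ‖(y : 𝔼 (n + 1))‖ = 1 := norm_eq_of_mem_sphere y
  have := norm_sq_eq_norm_init_sq_add (y : 𝔼 (n + 1))
  rw [hy, one_pow] at this
  linarith

/-- **Every point of `𝕊ⁿ` is a pole or has polar coordinates.** [folklore] -/
theorem eq_north_or_eq_south_or_mem_range (y : 𝕊 n) :
    y = north n ∨ y = south n ∨ y ∈ range (polar n) := by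
  set t : ℝ := (y : 𝔼 (n + 1)) (Fin.last n) with ht
  have hinit := norm_init_sq y
  rw [← ht] at hinit
  have ht1 : t ^ 2 ≤ 1 := by nlinarith [norm_nonneg (init (y : 𝔼 (n + 1)))]
  have htI : -1 ≤ t ∧ t ≤ 1 := by
    constructor <;> nlinarith [ht1, sq_nonneg (t - 1), sq_nonneg (t + 1)]
  by_cases h0 : init (y : 𝔼 (n + 1)) = 0
  · -- a pole
    rw [h0, norm_zero] at hinit
    have ht' : t = 1 ∨ t = -1 := by
      have h2 : (t - 1) * (t + 1) = 0 := by nlinarith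
      rcases mul_eq_zero.1 h2 with h | h
      · exact Or.inl (by linarith)
      · exact Or.inr (by linarith)
    rcases ht' with h1 | h1
    · left
      apply Subtype.ext
      rw [← snoc_init (y : 𝔼 (n + 1)), h0, ← ht, h1, coe_north]
    · right; left
      apply Subtype.ext
      rw [← snoc_init (y : 𝔼 (n + 1)), h0, ← ht, h1, coe_south]
  · -- polar coordinates `s = arccos t / π`, `u = init y / ‖init y‖`
    right; right
    have hpos : 0 < ‖init (y : 𝔼 (n + 1))‖ := norm_pos_iff.2 h0
    set r : ℝ := ‖init (y : 𝔼 (n + 1))‖ with hr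
    let u : sphere (0 : 𝔼 n) 1 := ⟨r⁻¹ • init (y : 𝔼 (n + 1)), by
      rw [mem_sphere_zero_iff_norm, norm_smul, norm_inv, Real.norm_eq_abs, abs_of_pos hpos,
        inv_mul_cancel₀ hpos.ne']⟩
    have hs : Real.arccos t / π ∈ Icc (0 : ℝ) 1 :=
      ⟨div_nonneg (Real.arccos_nonneg t) Real.pi_pos.le,
        (div_le_one Real.pi_pos).2 (Real.arccos_le_pi t)⟩
    refine ⟨(u, ⟨Real.arccos t / π, hs⟩), ?_⟩
    apply Subtype.ext
    have hπ : π * (Real.arccos t / π) = Real.arccos t := mul_div_cancel₀ _ Real.pi_pos.ne'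
    simp only [coe_polar, hπ]
    rw [Real.cos_arccos htI.1 htI.2, Real.sin_arccos]
    have hsq : Real.sqrt (1 - t ^ 2) = r := by
      rw [← hinit, Real.sqrt_sq hpos.le]
    rw [hsq, smul_smul, mul_inv_cancel₀ hpos.ne', one_smul, ht, snoc_init]

end SphereSuspension

/-- **`Sⁿ` is a suspension model of `Sⁿ⁻¹`** via polar coordinates
`(u, s) ↦ (sin (π s) u, cos (π s))`, for every `n : ℕ` (for `n = 0`: `S⁻¹ = ∅` and
`S⁰ = {N, S}`) (Hatcher, *Algebraic Topology* (2002), Ch. 0, p. 8, `S Sⁿ = Sⁿ⁺¹`). [folklore] -/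
def sphereSuspensionModel (n : ℕ) : SuspensionModel (sphere (0 : 𝔼 n) 1) (𝕊 n) where
  map := SphereSuspension.polar n
  north := SphereSuspension.north n
  south := SphereSuspension.south n
  continuous_map := SphereSuspension.continuous_polar
  map_zero := SphereSuspension.polar_zero
  map_one := SphereSuspension.polar_one
  north_ne_south := SphereSuspension.north_ne_south
  cover := SphereSuspension.eq_north_or_eq_south_or_mem_range
  eq_of_map_eq _ _ _ _ h := SphereSuspension.eq_of_polar_eq h

/-- The suspension coordinates of `sphereSuspensionModel n` are the polar coordinates. [folklore] -/
@[simp] theorem sphereSuspensionModel_map (n : ℕ) :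
    (sphereSuspensionModel n).map = SphereSuspension.polar n := rfl


/-- **Corollary (suspension-like spaces over `Sⁿ⁻¹` are homotopy `n`-spheres).** A Hausdorff space
covered by two disjoint closed contractible pieces joined by an embedded cylinder
`Sⁿ⁻¹ × [0, 1]` (`SuspensionLikeCover (sphere (0 : ℝⁿ) 1) P`) is homotopy equivalent to the unit
sphere `𝕊ⁿ ⊂ ℝⁿ⁺¹` (Hatcher, *Algebraic Topology* (2002), Prop. 0.17, Example 0.15 and p. 8).
[cite: HatcherAT2002, Ch. 0, Prop. 0.17, Example 0.15 and p. 8] -/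
theorem SuspensionLikeCover.nonempty_homotopyEquiv_sphere {n : ℕ} {P : Type w} [TopologicalSpace P]
    [T2Space P] (c : SuspensionLikeCover (sphere (0 : 𝔼 n) 1) P) (h₀ : ContractibleSpace c.body₀)
    (h₁ : ContractibleSpace c.body₁) : Nonempty (P ≃ₕ 𝕊 n) :=
  c.nonempty_homotopyEquiv (sphereSuspensionModel n) h₀ h₁

end Sphere

end Literature.AlgebraicTopology.Homotopy
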